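import Summits.Ventures.HodgeRepro2.T5SU11JacobiCompleteMonotone
import Summits.Ventures.HodgeRepro2.T5SU11JacobiLaplacePhase

/-!
# The iterated differences in the phase variable; the decay ratio of the transform is monotone

`T5SU11JacobiCompleteMonotone` gives `(−1)^n Δ_h^n m̂_·(λ)(k) = ∫_G m_k (1 − m_h)^n φ_λ dν ≥ 0`. Through the
law of the phase (`T5SU11PhaseLaw.integral_phase_eq`, `s(g) = log|a(g)|`, `m_k = e^{−k s}`) and the phase
form `Φ_λ(s) = φ_λ(a_{t(s)})` of the spherical function (`T5SU11JacobiLaplacePhase.sphPhase`) this is the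
Laplace-transform identity

  **`(−1)^n Δ_h^n m̂_·(λ)(k) = 2π ∫_0^∞ e^{−(k−2)s} (1 − e^{−hs})^n Φ_λ(s) ds`**   (`jacobi_fwdDiff_iter_eq_phase`)

— the `n`-th difference of a Laplace transform `∫ e^{−ks} dμ(s)` of the positive measure
`dμ = 2π e^{2s} Φ_λ(s) ds` is the transform of `(1 − e^{−hs})^n dμ`; the difference `m̂_k − m̂_{k+h}` in
this form (`jacobi_first_difference_eq_phase`), the midpoint form `m̂_{(k₁+k₂)/2}² ≤ m̂_{k₁} m̂_{k₂}` of the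
log-convexity (`jacobi_midpoint_sq_le`), and its slope form: **the decay ratio `m̂_{k+h}(λ)/m̂_k(λ)` is
monotone in the weight `k`** (`jacobi_ratio_le`), i.e. the transform decays ever more slowly — the
log-convexity of `T5SU11JacobiWeight` read through `ConvexOn.secant_mono`. Nothing is claimed about (N).

Blind lane: Mathlib + the HodgeRepro2 prefix only; no sorry; axioms ⊆ {propext, Classical.choice,
Quot.sound}.
-/

namespace Summit.Ventures.HodgeRepro2.T5SU11JacobiCompleteMonotonePhase

open MeasureTheory MeasureTheory.Measure Metric Set Filter Topology
open T5SU11Unimodular T5SU11Fibration T5SU11Cartan T5SU11OneParameter T5SU11CartanProjection T5HaarCircle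
  T5BergmanCoefficient T5SU11FibrationHaar T5SU11SphericalFunction T5SU11SphericalSymmetry
  T5SU11SphericalBounds T5SU11SphericalContinuous T5SU11JacobiIwasawa T5SU11JacobiTransform
  T5SU11JacobiWeight T5SU11PhaseLaw T5SU11KFiniteMajorantPow T5SU11JacobiLaplacePhase
  T5SU11JacobiCompleteMonotone
open scoped Real

section measure

variable [MeasurableSpace Circle] [BorelSpace Circle]

/-! ### The phase form of the difference integrand -/

/-- The difference integrand in the phase variable, `G_{k,h,n}(s) = e^{−ks} (1 − e^{−hs})^n Φ_λ(s)`, is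
continuous. -/
theorem continuous_diffPhase (k h lam : ℝ) (n : ℕ) :
    Continuous fun s : ℝ => Real.exp (-(k * s)) * (1 - Real.exp (-(h * s))) ^ n * sphPhase lam s :=
  ((Real.continuous_exp.comp (continuous_const.mul continuous_id).neg).mul
    ((continuous_const.sub (Real.continuous_exp.comp (continuous_const.mul continuous_id).neg)).pow n)).mul
    (continuous_sphPhase lam)

/-- `G_{k,h,n}(s) ≥ 0` for `h ≥ 0`, `s ≥ 0`. -/
theorem diffPhase_nonneg {h : ℝ} (hh : 0 ≤ h) (k lam : ℝ) (n : ℕ) {s : ℝ} (hs : 0 ≤ s) :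
    0 ≤ Real.exp (-(k * s)) * (1 - Real.exp (-(h * s))) ^ n * sphPhase lam s := by
  have : Real.exp (-(h * s)) ≤ 1 := Real.exp_le_one_iff.mpr (by nlinarith)
  exact mul_nonneg (mul_nonneg (Real.exp_pos _).le (pow_nonneg (sub_nonneg.mpr this) n))
    (sphPhase_pos lam s).le

/-- The difference integrand on `G` is `G_{k,h,n}(log|a(g)|)`. -/
theorem diff_integrand_eq_diffPhase (k h lam : ℝ) (n : ℕ) (g : SU11) :
    (1 - ‖orbit g‖ ^ 2) ^ (k / 2) * (1 - (1 - ‖orbit g‖ ^ 2) ^ (h / 2)) ^ n * sph lam g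
      = (fun s : ℝ => Real.exp (-(k * s)) * (1 - Real.exp (-(h * s))) ^ n * sphPhase lam s)
          (Real.log ‖mat g 0 0‖) := by
  simp only
  rw [orbit_rpow_eq_exp, orbit_rpow_eq_exp, sph_eq_sphPhase]

/-! ### The Laplace form of the iterated differences -/

/-- **THE `n`-TH DIFFERENCE IN LAPLACE FORM**: for `k` on the ray and `h ≥ 0`,
`(−1)^n Δ_h^n m̂_·(λ)(k) = 2π ∫_0^∞ e^{−(k−2)s} (1 − e^{−hs})^n Φ_λ(s) ds`. -/
theorem jacobi_fwdDiff_iter_eq_phase {k lam : ℝ} (hk : 1 < k) (h1 : lam < k) (h2 : 2 < k + lam)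
    {h : ℝ} (hh : 0 ≤ h) (n : ℕ) :
    (-1 : ℝ) ^ n * ((fwdDiff h)^[n] (fun k => ∫ g, (1 - ‖orbit g‖ ^ 2) ^ (k / 2) * sph lam g
        ∂(nu haarCircle)) k)
      = 2 * π * ∫ s in Ioi (0 : ℝ),
          Real.exp (-((k - 2) * s)) * (1 - Real.exp (-(h * s))) ^ n * sphPhase lam s := by
  rw [jacobi_fwdDiff_iter_eq hk h1 h2 hh n]
  have hint : Integrable (fun g => (fun s : ℝ => Real.exp (-(k * s)) * (1 - Real.exp (-(h * s))) ^ n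
      * sphPhase lam s) (Real.log ‖mat g 0 0‖)) (nu haarCircle) :=
    (integrable_orbit_rpow_mul_one_sub_pow_mul_sph hk h1 h2 hh n).congr
      (Filter.Eventually.of_forall fun g => diff_integrand_eq_diffPhase k h lam n g)
  rw [integral_congr_ae (Filter.Eventually.of_forall fun g => diff_integrand_eq_diffPhase k h lam n g),
    integral_phase_eq (continuous_diffPhase k h lam n) (fun s hs => diffPhase_nonneg hh k lam n hs) hint]
  congr 1
  refine setIntegral_congr_fun measurableSet_Ioi fun s _ => ?_
  rw [show Real.exp (-(k * s)) * (1 - Real.exp (-(h * s))) ^ n * sphPhase lam s * Real.exp (2 * s)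
      = (Real.exp (-(k * s)) * Real.exp (2 * s)) * (1 - Real.exp (-(h * s))) ^ n * sphPhase lam s by ring,
    ← Real.exp_add]
  congr 3
  ring

/-- The difference `m̂_k(λ) − m̂_{k+h}(λ) = 2π ∫_0^∞ e^{−(k−2)s} (1 − e^{−hs}) Φ_λ(s) ds`. -/
theorem jacobi_first_difference_eq_phase {k lam : ℝ} (hk : 1 < k) (h1 : lam < k) (h2 : 2 < k + lam)
    {h : ℝ} (hh : 0 ≤ h) :
    ∫ g, (1 - ‖orbit g‖ ^ 2) ^ (k / 2) * sph lam g ∂(nu haarCircle)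
      - ∫ g, (1 - ‖orbit g‖ ^ 2) ^ ((k + h) / 2) * sph lam g ∂(nu haarCircle)
      = 2 * π * ∫ s in Ioi (0 : ℝ),
          Real.exp (-((k - 2) * s)) * (1 - Real.exp (-(h * s))) * sphPhase lam s := by
  have := jacobi_fwdDiff_iter_eq_phase hk h1 h2 hh 1
  simp only [Function.iterate_one, fwdDiff, pow_one, neg_one_mul, neg_sub] at this
  exact this

/-- Non-negativity read in the phase: `∫_0^∞ e^{−(k−2)s} (1 − e^{−hs})^n Φ_λ(s) ds ≥ 0` (and the Laplace form
agrees with the group form of `T5SU11JacobiCompleteMonotone`). -/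
theorem integral_diffPhase_nonneg {k lam : ℝ} (hk : 1 < k) (h1 : lam < k) (h2 : 2 < k + lam)
    {h : ℝ} (hh : 0 ≤ h) (n : ℕ) :
    0 ≤ ∫ s in Ioi (0 : ℝ),
        Real.exp (-((k - 2) * s)) * (1 - Real.exp (-(h * s))) ^ n * sphPhase lam s := by
  have h0 := jacobi_fwdDiff_iter_nonneg hk h1 h2 hh n
  rw [jacobi_fwdDiff_iter_eq_phase hk h1 h2 hh n] at h0
  have hpi : (0 : ℝ) < 2 * π := by positivity
  by_contra hneg
  have := mul_neg_of_pos_of_neg hpi (not_le.mp hneg)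
  linarith

/-! ### The log-convexity in midpoint and slope form -/

/-- Midpoint form of the log-convexity: `m̂_{(k₁+k₂)/2}(λ)² ≤ m̂_{k₁}(λ) m̂_{k₂}(λ)` on the ray. -/
theorem jacobi_midpoint_sq_le {lam k₁ k₂ : ℝ} (hk₁ : 1 < k₁) (h11 : lam < k₁) (h12 : 2 < k₁ + lam)
    (hk₂ : 1 < k₂) (h21 : lam < k₂) (h22 : 2 < k₂ + lam) :
    (∫ g, (1 - ‖orbit g‖ ^ 2) ^ ((k₁ + k₂) / 2 / 2) * sph lam g ∂(nu haarCircle)) ^ 2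
      ≤ (∫ g, (1 - ‖orbit g‖ ^ 2) ^ (k₁ / 2) * sph lam g ∂(nu haarCircle))
        * ∫ g, (1 - ‖orbit g‖ ^ 2) ^ (k₂ / 2) * sph lam g ∂(nu haarCircle) := by
  have h := jacobi_mul_add_mul_le hk₁ h11 h12 hk₂ h21 h22 (a := 1 / 2) (b := 1 / 2) (by norm_num)
    (by norm_num) (by norm_num)
  have hm : 0 ≤ ∫ g, (1 - ‖orbit g‖ ^ 2) ^ ((k₁ + k₂) / 2 / 2) * sph lam g ∂(nu haarCircle) :=
    (jacobi_pos (by linarith) (by linarith) (by linarith)).le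
  have hxpos := jacobi_pos hk₁ h11 h12
  have hypos := jacobi_pos hk₂ h21 h22
  rw [show (1 / 2 : ℝ) * k₁ + 1 / 2 * k₂ = (k₁ + k₂) / 2 by ring] at h
  calc (∫ g, (1 - ‖orbit g‖ ^ 2) ^ ((k₁ + k₂) / 2 / 2) * sph lam g ∂(nu haarCircle)) ^ 2
      ≤ ((∫ g, (1 - ‖orbit g‖ ^ 2) ^ (k₁ / 2) * sph lam g ∂(nu haarCircle)) ^ (1 / 2 : ℝ)
          * (∫ g, (1 - ‖orbit g‖ ^ 2) ^ (k₂ / 2) * sph lam g ∂(nu haarCircle)) ^ (1 / 2 : ℝ)) ^ 2 :=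
        pow_le_pow_left₀ hm h 2
    _ = (∫ g, (1 - ‖orbit g‖ ^ 2) ^ (k₁ / 2) * sph lam g ∂(nu haarCircle))
        * ∫ g, (1 - ‖orbit g‖ ^ 2) ^ (k₂ / 2) * sph lam g ∂(nu haarCircle) := by
        rw [mul_pow, ← Real.rpow_natCast, ← Real.rpow_natCast, ← Real.rpow_mul hxpos.le,
          ← Real.rpow_mul hypos.le]
        norm_num

/-- **THE DECAY RATIO IS MONOTONE IN THE WEIGHT**: for `k₁ ≤ k₂` on the ray and `h > 0`,
`m̂_{k₁+h}(λ)/m̂_{k₁}(λ) ≤ m̂_{k₂+h}(λ)/m̂_{k₂}(λ)` — the slope form of the log-convexity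
(`ConvexOn.secant_mono` applied twice to `log m̂`). -/
theorem jacobi_ratio_le {lam k₁ k₂ h : ℝ} (hk₁ : 1 < k₁) (h11 : lam < k₁) (h12 : 2 < k₁ + lam)
    (hk : k₁ ≤ k₂) (hh : 0 < h) :
    (∫ g, (1 - ‖orbit g‖ ^ 2) ^ ((k₁ + h) / 2) * sph lam g ∂(nu haarCircle))
        / ∫ g, (1 - ‖orbit g‖ ^ 2) ^ (k₁ / 2) * sph lam g ∂(nu haarCircle)
      ≤ (∫ g, (1 - ‖orbit g‖ ^ 2) ^ ((k₂ + h) / 2) * sph lam g ∂(nu haarCircle))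
        / ∫ g, (1 - ‖orbit g‖ ^ 2) ^ (k₂ / 2) * sph lam g ∂(nu haarCircle) := by
  set F : ℝ → ℝ := fun k => ∫ g, (1 - ‖orbit g‖ ^ 2) ^ (k / 2) * sph lam g ∂(nu haarCircle) with hF
  have hconv := convexOn_log_jacobi_weight lam
  have mem : ∀ k, k₁ ≤ k → k ∈ Ioi (max 1 (max lam (2 - lam))) := fun k hk' => by
    rw [Set.mem_Ioi, max_lt_iff, max_lt_iff]
    exact ⟨by linarith, by linarith, by linarith⟩
  have pos : ∀ k, k₁ ≤ k → 0 < F k := fun k hk' =>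
    jacobi_pos (by linarith) (by linarith) (by linarith)
  -- slopes of `log F`: `s(k₁, k₁ + h) ≤ s(k₁, k₂ + h) ≤ s(k₂, k₂ + h)`
  have s1 : (Real.log (F (k₁ + h)) - Real.log (F k₁)) / (k₁ + h - k₁)
      ≤ (Real.log (F (k₂ + h)) - Real.log (F k₁)) / (k₂ + h - k₁) :=
    hconv.secant_mono (mem k₁ le_rfl) (mem (k₁ + h) (by linarith)) (mem (k₂ + h) (by linarith))
      (lt_add_of_pos_right k₁ hh).ne' (by linarith : k₁ < k₂ + h).ne' (by linarith)
  have s2 : (Real.log (F k₁) - Real.log (F (k₂ + h))) / (k₁ - (k₂ + h))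
      ≤ (Real.log (F k₂) - Real.log (F (k₂ + h))) / (k₂ - (k₂ + h)) :=
    hconv.secant_mono (mem (k₂ + h) (by linarith)) (mem k₁ le_rfl) (mem k₂ hk)
      (by linarith : k₁ < k₂ + h).ne (lt_add_of_pos_right k₂ hh).ne hk
  have e1 : (Real.log (F k₁) - Real.log (F (k₂ + h))) / (k₁ - (k₂ + h))
      = (Real.log (F (k₂ + h)) - Real.log (F k₁)) / (k₂ + h - k₁) := by
    rw [← neg_sub (Real.log (F (k₂ + h))), ← neg_sub (k₂ + h), neg_div_neg_eq]
  have e2 : (Real.log (F k₂) - Real.log (F (k₂ + h))) / (k₂ - (k₂ + h))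
      = (Real.log (F (k₂ + h)) - Real.log (F k₂)) / (k₂ + h - k₂) := by
    rw [← neg_sub (Real.log (F (k₂ + h))), ← neg_sub (k₂ + h), neg_div_neg_eq]
  rw [e1, e2] at s2
  have s3 : (Real.log (F (k₁ + h)) - Real.log (F k₁)) / h
      ≤ (Real.log (F (k₂ + h)) - Real.log (F k₂)) / h := by
    have := s1.trans s2
    rwa [add_sub_cancel_left, add_sub_cancel_left] at this
  have s4 : Real.log (F (k₁ + h)) - Real.log (F k₁) ≤ Real.log (F (k₂ + h)) - Real.log (F k₂) :=
    (div_le_div_iff_of_pos_right hh).mp s3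
  rw [← Real.log_div (pos _ (by linarith)).ne' (pos _ le_rfl).ne',
    ← Real.log_div (pos _ (by linarith)).ne' (pos _ hk).ne'] at s4
  exact (Real.log_le_log_iff (div_pos (pos _ (by linarith)) (pos _ le_rfl))
    (div_pos (pos _ (by linarith)) (pos _ hk))).mp s4

end measure

end Summit.Ventures.HodgeRepro2.T5SU11JacobiCompleteMonotonePhase
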